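import Summits.BirchSwinnertonDyer.BirchSwinnertonDyer.Theorems.EisensteinPrimesBSDpOnCellCTelescopeK2BigRepDeterminant
import Summits.BirchSwinnertonDyer.BirchSwinnertonDyer.Theorems.EisensteinPrimesBSDpOnCellCTelescopeK2RepDescent
import Summits.BirchSwinnertonDyer.BirchSwinnertonDyer.Theorems.SignedBaseChangeAnticyclotomicEisensteinDivisibilityTwistDeformationLOC1
import Summits.BirchSwinnertonDyer.BirchSwinnertonDyer.Theorems.ErratumRoadFiveAnticyclotomicLocalImage
import Summits.BirchSwinnertonDyer.BirchSwinnertonDyer.Theorems.EisensteinPrimesBSDpOnCellCTelescopeK2FinitelyDecomposedFrobenius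
import HarnessLib

/-!
# Crux 4 `BSDpOnCellC` (stmt-BirchSwinnertonDyer-19034), line «telescope» v13, leaf N2 (fact-free W4⁰ endpoint): the LOCAL GALOIS ROWS
# `hLOC1` / `hLOC1𝔮` / `h0𝔮` for `𝐃 = BigRepModule 𝒪 p A` — LOC_v⁽¹⁾(𝐃) and `corank H⁰(K_v, 𝐃) = 0` for
# `descendUnramified S (AnticyclotomicBigGaloisRep κ ρ) hS` from ONE `σ ∈ Γ_{K_v}` with `κ(σ) ≠ 1`, for a COFREE `A` of ANY corank over a
# GENERAL domain `𝒪 ⊇ ℤ_p` and ANY `ρ`; and the anticyclotomic instances above `p` (helper, `--supports stmt-BirchSwinnertonDyer-19034`)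

Cell `bsd-eis`, width seat `bsd-line-x2-p2` (prover g22, 2026-08-30; D-0154 KEY row 5). THEOREMS ONLY (no definition, no named fact, no
instance, no notation, no `sorry`). HONEST FRAMING: Galois-side wrappers of this seat's `TelescopeK2BigRepDeterminant` (Greenberg 2010
Lemma 5.2.2, determinant form, one variable); they discharge, for the telescope's `𝒪 = ℤ_p⟦X⟧ = IwasawaAlgebra p` and a COFREE `A₂`
((cof) of telescope v13's N1), three of the four local rows left open by ideator bsd-idea-12 g40's fact-free W4⁰ endpoint
`TelescopeK2PurityFactFree.forall_isPseudoNull_XBig_exists_pow_smul_eq_zero_factFree` (binders `hLOC1` at the places above `p`, `hLOC1𝔮`,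
`h0𝔮`; cell instance `𝔮 = 𝔭̄`, `Sig = ∅`). They do NOT prove N1, N2, the crux, or any summit statement; BSD is proved for no curve.

* §1 (generic `K`, `S`, `𝒪`, `A`, `κ`, `ρ`; one `σ ∈ Γ_{K_v}` with `κ(σ̄) ≠ 1`; a `K̄ˣ`-valued, resp. Pontryagin, dual datum of `A` free of
  finite rank over `𝒪`): **`loc1_descendUnramified_of_basis`** — `Greenberg2016.LOC1 S (descendUnramified S (AnticyclotomicBigGaloisRep κ ρ) hS) v`;
  **`hasCorank_localH0_descendUnramified_zero_of_basis`** — `HasCorank 𝒪⟦T⟧ ((localRep S (descendUnramified …) v).H 0) 0`. (`σ` acts on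
  `𝐃` as `(ρ σ̄)_* ∘ ((1+T)^{−κ(σ̄)} • ·)`, `TelescopeK2BigRepDeterminant.bigRep_apply_eq_mapRange_binomSeries_smul`; then the LOC-core and the H⁰-core.)
* §2 from (cof): `exists_tateDual_bases_of_isCofree` (a `K̄ˣ`-valued dual datum of a `p`-primary cofree `A` with a finite `𝒪`-basis, `K` of
  characteristic `0`: Prüfer embedding `ℚ_p/ℤ_p ↪ K̄ˣ`, tree `QpModZp.exists_injective_units` / `unitsCarrier_torsionBound`);
  **`loc1_descendUnramified_of_isCofree`**, **`hasCorank_localH0_descendUnramified_zero_of_isCofree`**.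
* §3 the anticyclotomic instances ABOVE `p` (`K` imaginary quadratic, `p` odd, `κ` anticyclotomic: the decomposition group of `v ∣ p` has
  open image under `κ`, tree `AnticyclotomicLocalImage.anticyclotomic_exists_forall_exists_toAdd_eq_pow_mul`):
  `exists_apply_absGaloisRestrict_ne_one_of_isAnticyclotomic`, **`loc1_descendUnramified_of_isAnticyclotomic`** (= rows `hLOC1` at `w ∣ p`
  and `hLOC1𝔮`), **`hasCorank_localH0_descendUnramified_zero_of_isAnticyclotomic`** (= row `h0𝔮`), for every cofree `p`-primary `A` over a
  domain `𝒪` with `ℤ_p ↪ 𝒪` and every `ρ`.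

Also §3: the same two statements at every DEGREE-ONE `w ∤ p` (the split primes `w ∣ N`; σ-supply = x2-p2 g19's
`TelescopeK2FinitelyDecomposedFrobenius.exists_isFrobPow_anticyclotomic_ne_zero`) — the LOC⁽¹⁾_w / `h⁰_w = 0` inputs of the fourth row `hcot`
(`H¹(K_w, 𝐃)` cotorsion, via Greenberg 2006 Prop. 4.2 (b) + §5 A; that local Euler-characteristic step is not done here).

References: R. Greenberg, Kyoto J. Math. 50 (2010), Lemma 5.2.2 (PDF p. 28 L20–21), §5 [Greenberg2010]; R. Greenberg, Doc. Math. Extra Vol.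
Coates (2006), p. 342, §4 A Props. 4.1–4.2 [Greenberg2006]; R. Greenberg, *On the structure of Selmer groups* (2016) §2.1 p. 6, §4.3 p. 20
L26–30 [Greenberg2016Selmer]; D. Brink, Proc. AMS 135 (2007) Cor. 1 (anticyclotomic decomposition groups) [Brink2007].
-/

set_option linter.dupNamespace false
set_option autoImplicit false

noncomputable section

open scoped Classical
open PowerSeries NumberField IsDedekindDomain Field
open Literature.NumberTheory.EllipticCurves Literature.NumberTheory.EllipticCurves.BigRepModule
  Literature.NumberTheory.GaloisRepresentations
  Literature.NumberTheory.IwasawaTheory Literature.NumberTheory.IwasawaTheory.Greenberg2016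
  Literature.NumberTheory.IwasawaTheory.Greenberg2006

namespace Summit.BirchSwinnertonDyer.BirchSwinnertonDyer.Theorems.TelescopeK2BigRepLOC1

open Summit.BirchSwinnertonDyer.BirchSwinnertonDyer.Theorems

/-! ## §1 LOC_v⁽¹⁾ and `corank H⁰(K_v, 𝐃) = 0` from one `σ` with `κ(σ) ≠ 1`, given dual bases -/

section Generic

variable {K : Type} [Field K] [NumberField K] (S : Set (HeightOneSpectrum (𝓞 K))) {p : ℕ} [Fact p.Prime]
  {𝒪 : Type} [CommRing 𝒪] [IsDomain 𝒪] [Algebra ℤ_[p] 𝒪] [TopologicalSpace 𝒪]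
  {A : Type} [AddCommGroup A] [Module 𝒪 A] [TopologicalSpace A] [DiscreteTopology A]
  [TopologicalSpace (PowerSeries 𝒪)]
  (κ : ZpExtension K p) (ρ : ContinuousRep (absoluteGaloisGroup K) 𝒪 A)
  (hS : ramificationSubgroup K S ≤ (AnticyclotomicBigGaloisRep κ ρ).ker)
  (hinj : Function.Injective (algebraMap ℤ_[p] 𝒪)) (hA : ∀ a : A, ∃ k : ℕ, p ^ k • a = 0)

omit [NumberField K] in
/-- `κ(σ̄) ≠ 1` read additively on the structure map: `−κ(σ̄) ≠ 0`. [folklore] -/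
theorem neg_toAdd_ne_zero {g : absoluteGaloisGroup K} (hκ : κ g ≠ 1) : -(κ.toContinuousMonoidHom g).toAdd ≠ 0 := by
  rw [ZpExtension.coe_toContinuousMonoidHom]
  exact neg_ne_zero.mpr fun h0 ↦ hκ (toAdd_eq_zero.mp h0)

include hinj hA in
/-- **Greenberg 2010 Lemma 5.2.2 — LOC_v⁽¹⁾(𝐃) for `𝐃 = A ⊗ Λ_𝒪^*(κ⁻¹)` (on `G_{K,Σ}` via `descendUnramified`), cofree `A` of ANY corank, ANY
`ρ`: "Suppose that `v ∈ Σ` and that the decomposition subgroup of `Γ` for `v` is nontrivial. Then `H⁰(K_v, T*) = 0`."** Hypotheses: `A`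
`p`-primary with a `K̄ˣ`-valued dual datum free of rank `n` over the domain `𝒪 ⊇ ℤ_p` (`hY`, `b`), and ONE `σ ∈ Γ_{K_v}` with `κ(σ̄) ≠ 1`
— no condition on `ρ(σ̄)`, none on `σ|μ_{p^∞}`. Proof: `σ` acts on `𝐃` as `(ρ σ̄)_* ∘ ((1+T)^{−κ σ̄} • ·)`
(`bigRep_apply_eq_mapRange_binomSeries_smul`), and the LOC-core `eq_zero_of_apply_mapRange_binomSeries_smul` with `s = σ|_{K̄ˣ}`. One-variable,
general-`𝒪` twin of bsd-ssimc's `SignedBaseChangeAcDivTwistLOC1.twistDeformation_LOC1_of_basis`. [cite: Greenberg2010, Lemma 5.2.2 (PDF p. 28 L20–21)]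
[cite: Greenberg2016Selmer, §4.3 p. 20 L26–30] -/
theorem loc1_descendUnramified_of_basis
    {Y : Type} [AddCommGroup Y] [Module 𝒪 Y] {tA : Y →+ (A →+ DiscreteGaloisModule.UnitsCarrier K)}
    (hY : IsDualPairing 𝒪 A tA) {n : ℕ} (b : Module.Basis (Fin n) 𝒪 Y)
    (v : Place K) (σ : absoluteGaloisGroup v.Completion) (hκ : κ (absGaloisRestrict K v.Completion σ) ≠ 1) :
    LOC1 S (TelescopeK2RepDescent.descendUnramified S (AnticyclotomicBigGaloisRep κ ρ) hS) v := by
  intro f hf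
  refine TelescopeK2BigRepDeterminant.eq_zero_of_apply_mapRange_binomSeries_smul hinj hA hY b
    (ρ (absGaloisRestrict K v.Completion σ)) (ρ (absGaloisRestrict K v.Completion σ)⁻¹)
    (SignedBaseChangeAcDivTwistLOC1.apply_apply_inv ρ _) (neg_toAdd_ne_zero κ hκ)
    (DiscreteGaloisModule.units K (absGaloisRestrict K v.Completion σ)).toAddMonoidHom f fun Φ ↦ ?_
  rw [← TelescopeK2BigRepDeterminant.bigRep_apply_eq_mapRange_binomSeries_smul]
  exact hf σ Φ

include hinj hA in
/-- **`corank_{𝒪⟦T⟧} H⁰(K_v, 𝐃) = 0` for `𝐃 = A ⊗ Λ_𝒪^*(κ⁻¹)`, cofree `A` of ANY corank, ANY `ρ`**, from ONE `σ ∈ Γ_{K_v}` with `κ(σ̄) ≠ 1` and a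
free Pontryagin dual of `A` (`hY₀`, `b₀`): the H⁰-core scalar `det((1+T)^{−κ σ̄} · Q_{ρ σ̄} − 1) ≠ 0` kills `𝐃^σ ⊇ 𝐃^{Γ_{K_v}}`
(bsd-ssimc's `SignedBaseChangeAcDivTwistLOC1.hasCorank_H0_zero_of_forall_fixed_smul_eq_zero`). The term `h⁰_v = 0` of [Greenberg2006] Prop. 4.2
for `𝐃`. [cite: Greenberg2006, Prop. 4.2 (§4 A, p. 368)] [cite: Greenberg2010, Lemma 5.2.2 (PDF p. 28 L20–21)] -/
theorem hasCorank_localH0_descendUnramified_zero_of_basis [IsTopologicalAddGroup (BigRepModule 𝒪 p A)]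
    [ContinuousSMul (PowerSeries 𝒪) (BigRepModule 𝒪 p A)]
    {Y₀ : Type} [AddCommGroup Y₀] [Module 𝒪 Y₀] {t₀ : Y₀ →+ (A →+ AddCircle (1 : ℚ))}
    (hY₀ : IsDualPairing 𝒪 A t₀) {n₀ : ℕ} (b₀ : Module.Basis (Fin n₀) 𝒪 Y₀)
    (v : Place K) (σ : absoluteGaloisGroup v.Completion) (hκ : κ (absGaloisRestrict K v.Completion σ) ≠ 1) :
    HasCorank (PowerSeries 𝒪)
      ((localRep S (TelescopeK2RepDescent.descendUnramified S (AnticyclotomicBigGaloisRep κ ρ) hS) v).H 0) 0 := by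
  obtain ⟨lam, hlam, hkill⟩ :=
    TelescopeK2BigRepDeterminant.exists_ne_zero_smul_eq_zero_of_mapRange_binomSeries_smul_eq hinj hA hY₀ b₀
      (ρ (absGaloisRestrict K v.Completion σ)) (ρ (absGaloisRestrict K v.Completion σ)⁻¹)
      (SignedBaseChangeAcDivTwistLOC1.apply_apply_inv ρ _) (neg_toAdd_ne_zero κ hκ)
  exact SignedBaseChangeAcDivTwistLOC1.hasCorank_H0_zero_of_forall_fixed_smul_eq_zero _ σ hlam fun Φ hΦ ↦
    hkill Φ (by rw [← TelescopeK2BigRepDeterminant.bigRep_apply_eq_mapRange_binomSeries_smul]; exact hΦ)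

end Generic

/-! ## §2 The dual bases from (cof) -/

section Cofree

variable {K : Type} [Field K] [NumberField K] (S : Set (HeightOneSpectrum (𝓞 K))) {p : ℕ} [Fact p.Prime]
  {𝒪 : Type} [CommRing 𝒪] [IsDomain 𝒪] [Algebra ℤ_[p] 𝒪] [TopologicalSpace 𝒪]
  {A : Type} [AddCommGroup A] [Module 𝒪 A] [TopologicalSpace A] [DiscreteTopology A]
  [TopologicalSpace (PowerSeries 𝒪)]
  (κ : ZpExtension K p) (ρ : ContinuousRep (absoluteGaloisGroup K) 𝒪 A)
  (hS : ramificationSubgroup K S ≤ (AnticyclotomicBigGaloisRep κ ρ).ker)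
  (hinj : Function.Injective (algebraMap ℤ_[p] 𝒪)) (hA : ∀ a : A, ∃ k : ℕ, p ^ k • a = 0) (hcof : IsCofree 𝒪 A)

omit [NumberField K] [IsDomain 𝒪] [Algebra ℤ_[p] 𝒪] [TopologicalSpace 𝒪] [TopologicalSpace A] [DiscreteTopology A]
  [TopologicalSpace (PowerSeries 𝒪)] in
include hA hcof in
/-- **A Tate dual `Hom(A, K̄ˣ)` with a finite `𝒪`-basis, for a `p`-primary COFREE `𝒪`-module `A`** (`K` of characteristic `0`, so that
`K̄ˣ ⊇ μ_{p^∞} ≅ ℚ_p/ℤ_p`: tree `QpModZp.exists_injective_units`, `unitsCarrier_torsionBound`), in the shape of `hY, b` of §1 — through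
`TelescopeK2BigRepDeterminant.exists_dual_bases_of_isCofree`. [cite: Greenberg2006, p. 338 lines 15–16 (`T* = Hom(D, μ_{p^∞})` free of rank `n`)] -/
theorem exists_tateDual_bases_of_isCofree [CharZero K] :
    ∃ (tA : CharacterModule A →+ (A →+ DiscreteGaloisModule.UnitsCarrier K)) (_ : IsDualPairing 𝒪 A tA) (n : ℕ),
      Nonempty (Module.Basis (Fin n) 𝒪 (CharacterModule A)) := by
  haveI : CharZero (AlgebraicClosure K) :=
    charZero_of_injective_algebraMap (algebraMap K (AlgebraicClosure K)).injective
  haveI : NeZero (p : AlgebraicClosure K) := ⟨Nat.cast_ne_zero.mpr (Fact.out : p.Prime).ne_zero⟩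
  obtain ⟨j, hj⟩ := QpModZp.exists_injective_units (p := p) (AlgebraicClosure K)
  let jC : QpModZp p →+ DiscreteGaloisModule.UnitsCarrier K :=
    (DiscreteGaloisModule.UnitsCarrier.toAdditive (K := K)).symm.toAddMonoidHom.comp j
  have hjC : Function.Injective jC :=
    (DiscreteGaloisModule.UnitsCarrier.toAdditive (K := K)).symm.injective.comp hj
  exact TelescopeK2BigRepDeterminant.exists_dual_bases_of_isCofree (𝒪 := 𝒪) hA hcof hjC
    (QpModZp.unitsCarrier_torsionBound K)

include hinj hA hcof in
/-- **LOC_v⁽¹⁾(𝐃) for a COFREE `A`** from one `σ ∈ Γ_{K_v}` with `κ(σ̄) ≠ 1` (§1 + the Tate-dual basis of §2).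
[cite: Greenberg2010, Lemma 5.2.2 (PDF p. 28 L20–21)] [cite: Greenberg2016Selmer, §4.3 p. 20 L26–30] -/
theorem loc1_descendUnramified_of_isCofree (v : Place K) (σ : absoluteGaloisGroup v.Completion)
    (hκ : κ (absGaloisRestrict K v.Completion σ) ≠ 1) :
    LOC1 S (TelescopeK2RepDescent.descendUnramified S (AnticyclotomicBigGaloisRep κ ρ) hS) v := by
  obtain ⟨tA, hY, n, ⟨b⟩⟩ := exists_tateDual_bases_of_isCofree (K := K) (p := p) hA hcof
  exact loc1_descendUnramified_of_basis S κ ρ hS hinj hA hY b v σ hκ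

include hinj hA hcof in
/-- **`corank_{𝒪⟦T⟧} H⁰(K_v, 𝐃) = 0` for a COFREE `A`** from one `σ ∈ Γ_{K_v}` with `κ(σ̄) ≠ 1` (§1 + the Pontryagin basis: (cof) read on
`Hom(A, ℚ/ℤ)` itself, `Greenberg2016.isDualPairing_characterModule`). [cite: Greenberg2006, Prop. 4.2 (§4 A, p. 368)]
[cite: Greenberg2010, Lemma 5.2.2 (PDF p. 28 L20–21)] -/
theorem hasCorank_localH0_descendUnramified_zero_of_isCofree [IsTopologicalAddGroup (BigRepModule 𝒪 p A)]
    [ContinuousSMul (PowerSeries 𝒪) (BigRepModule 𝒪 p A)]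
    (v : Place K) (σ : absoluteGaloisGroup v.Completion) (hκ : κ (absGaloisRestrict K v.Completion σ) ≠ 1) :
    HasCorank (PowerSeries 𝒪)
      ((localRep S (TelescopeK2RepDescent.descendUnramified S (AnticyclotomicBigGaloisRep κ ρ) hS) v).H 0) 0 := by
  obtain ⟨hfree, hfin⟩ := hcof (CharacterModule A) (AddMonoidHom.id _) (isDualPairing_characterModule 𝒪 A)
  haveI := hfree
  haveI := hfin
  let b₀ := (Module.Free.chooseBasis 𝒪 (CharacterModule A)).reindex (Fintype.equivFin _)
  exact hasCorank_localH0_descendUnramified_zero_of_basis S κ ρ hS hinj hA (isDualPairing_characterModule 𝒪 A) b₀ v σ hκ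

end Cofree

/-! ## §3 The anticyclotomic instances above `p` (rows `hLOC1` at `w ∣ p`, `hLOC1𝔮`, `h0𝔮`) -/

section Anticyclotomic

variable {K : Type} [Field K] [NumberField K] (S : Set (HeightOneSpectrum (𝓞 K))) {p : ℕ} [Fact p.Prime]
  {𝒪 : Type} [CommRing 𝒪] [IsDomain 𝒪] [Algebra ℤ_[p] 𝒪] [TopologicalSpace 𝒪]
  {A : Type} [AddCommGroup A] [Module 𝒪 A] [TopologicalSpace A] [DiscreteTopology A]
  [TopologicalSpace (PowerSeries 𝒪)]

/-- **`κ` is non-trivial on the decomposition group of a prime `v ∣ p`** (`K` imaginary quadratic, `p` odd, `κ` anticyclotomic): some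
`σ ∈ Γ_{K_v}` has `κ(res σ) ≠ 1` — from the OPEN IMAGE `AnticyclotomicLocalImage.anticyclotomic_exists_forall_exists_toAdd_eq_pow_mul`
(`p^s · 1` is attained and `p^s ≠ 0`). [cite: Brink2007, Cor. 1 (p. 2136)] [cite: Washington1997, §13.1] -/
theorem exists_apply_absGaloisRestrict_ne_one_of_isAnticyclotomic (hK : IsImaginaryQuadratic K) (hp2 : p ≠ 2)
    (κ : ZpExtension K p) (hκ : κ.IsAnticyclotomic) (v : HeightOneSpectrum (𝓞 K)) (hpv : ((p : ℕ) : 𝓞 K) ∈ v.asIdeal) :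
    ∃ σ : absoluteGaloisGroup (v.adicCompletion K), κ (absGaloisRestrict K (v.adicCompletion K) σ) ≠ 1 := by
  obtain ⟨s, hs⟩ := AnticyclotomicLocalImage.anticyclotomic_exists_forall_exists_toAdd_eq_pow_mul hK hp2 κ hκ v hpv
  obtain ⟨σ, hσ⟩ := hs 1
  refine ⟨σ, fun h1 ↦ ?_⟩
  rw [mul_one] at hσ
  have h0 : (κ (absGaloisRestrict K (v.adicCompletion K) σ)).toAdd = 0 := by rw [h1]; rfl
  rw [h0] at hσ
  exact pow_ne_zero s (Nat.cast_ne_zero.mpr (Fact.out : p.Prime).ne_zero) hσ.symm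

variable (κ : ZpExtension K p) (ρ : ContinuousRep (absoluteGaloisGroup K) 𝒪 A)
  (hS : ramificationSubgroup K S ≤ (AnticyclotomicBigGaloisRep κ ρ).ker)
  (hinj : Function.Injective (algebraMap ℤ_[p] 𝒪)) (hA : ∀ a : A, ∃ k : ℕ, p ^ k • a = 0) (hcof : IsCofree 𝒪 A)

include hinj hA hcof in
/-- **Rows `hLOC1` (at the places above `p`) and `hLOC1𝔮` of the fact-free W4⁰ endpoint**: LOC_w⁽¹⁾(𝐃) at EVERY prime `w ∣ p` of `K`, for
`𝐃 = A ⊗ Λ_𝒪^*(κ⁻¹)` of a `p`-primary COFREE `A` over a domain `𝒪 ⊇ ℤ_p` and ANY `ρ`, `K` imaginary quadratic, `p` odd, `κ` anticyclotomic.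
[cite: Greenberg2010, Lemma 5.2.2 (PDF p. 28 L20–21)] [cite: Greenberg2016Selmer, §4.3 p. 20 L26–30] [cite: Brink2007, Cor. 1] -/
theorem loc1_descendUnramified_of_isAnticyclotomic (hK : IsImaginaryQuadratic K) (hp2 : p ≠ 2) (hκ : κ.IsAnticyclotomic)
    (w : HeightOneSpectrum (𝓞 K)) (hpw : ((p : ℕ) : 𝓞 K) ∈ w.asIdeal) :
    LOC1 S (TelescopeK2RepDescent.descendUnramified S (AnticyclotomicBigGaloisRep κ ρ) hS) (Sum.inr w) := by
  obtain ⟨σ, hσ⟩ := exists_apply_absGaloisRestrict_ne_one_of_isAnticyclotomic hK hp2 κ hκ w hpw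
  exact loc1_descendUnramified_of_isCofree S κ ρ hS hinj hA hcof (Sum.inr w) σ hσ

include hinj hA hcof in
/-- **Row `h0𝔮` of the fact-free W4⁰ endpoint**: `corank_{𝒪⟦T⟧} H⁰(K_𝔮, 𝐃) = 0` at EVERY prime `𝔮 ∣ p` of `K`, same generality.
[cite: Greenberg2006, Prop. 4.2 (§4 A, p. 368)] [cite: Greenberg2010, Lemma 5.2.2 (PDF p. 28 L20–21)] [cite: Brink2007, Cor. 1] -/
theorem hasCorank_localH0_descendUnramified_zero_of_isAnticyclotomic [IsTopologicalAddGroup (BigRepModule 𝒪 p A)]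
    [ContinuousSMul (PowerSeries 𝒪) (BigRepModule 𝒪 p A)]
    (hK : IsImaginaryQuadratic K) (hp2 : p ≠ 2) (hκ : κ.IsAnticyclotomic)
    (𝔮 : HeightOneSpectrum (𝓞 K)) (hp𝔮 : ((p : ℕ) : 𝓞 K) ∈ 𝔮.asIdeal) :
    HasCorank (PowerSeries 𝒪)
      ((localRep S (TelescopeK2RepDescent.descendUnramified S (AnticyclotomicBigGaloisRep κ ρ) hS) (Sum.inr 𝔮)).H 0) 0 := by
  obtain ⟨σ, hσ⟩ := exists_apply_absGaloisRestrict_ne_one_of_isAnticyclotomic hK hp2 κ hκ 𝔮 hp𝔮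
  exact hasCorank_localH0_descendUnramified_zero_of_isCofree S κ ρ hS hinj hA hcof (Sum.inr 𝔮) σ hσ

/-- **`κ` is non-trivial on the decomposition group of a degree-one prime `w ∤ p`** (`K` imaginary quadratic, `κ` anticyclotomic; e.g. the
split primes `w ∣ N` under the Heegner hypothesis): some `σ ∈ Γ_{K_w}` has `κ(res σ) ≠ 1` — x2-p2 g19's
`TelescopeK2FinitelyDecomposedFrobenius.exists_isFrobPow_anticyclotomic_ne_zero` (Brink: a degree-one `w ∤ p` is finitely decomposed in
the anticyclotomic tower). [cite: Brink2007, Thm. 2 and Cor. 1] [cite: Washington1997, Prop. 13.2] -/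
theorem exists_apply_absGaloisRestrict_ne_one_of_degreeOne (hK : IsImaginaryQuadratic K) (κ : ZpExtension K p)
    (hκ : κ.IsAnticyclotomic) (w : HeightOneSpectrum (𝓞 K)) (hw : ((p : ℕ) : 𝓞 K) ∉ w.asIdeal)
    (he : w.asIdeal.ramificationIdx (𝓞 ℚ) = 1) (hf : w.asIdeal.inertiaDeg (𝓞 ℚ) = 1) :
    ∃ σ : absoluteGaloisGroup (w.adicCompletion K), κ (absGaloisRestrict K (w.adicCompletion K) σ) ≠ 1 := by
  obtain ⟨φ, c, -, hφ, hc⟩ :=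
    TelescopeK2FinitelyDecomposedFrobenius.exists_isFrobPow_anticyclotomic_ne_zero hK κ hκ w hw he hf
  refine ⟨φ, fun h1 ↦ hc ?_⟩
  have h : Multiplicative.ofAdd c = 1 := by rw [← hφ]; exact h1
  rwa [ofAdd_eq_one] at h

include hinj hA hcof in
/-- **LOC_w⁽¹⁾(𝐃) at a degree-one prime `w ∤ p`** (`K` imaginary quadratic, `κ` anticyclotomic; the split primes `w ∣ N`), cofree `A`, any `ρ`
— the LOC⁽¹⁾ half of the row `hcot` of the fact-free W4⁰ endpoint (with `h⁰_w = 0` below and Greenberg 2006 Prop. 4.2 (b), `corank H¹(K_w, 𝐃) = 0`).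
[cite: Greenberg2010, Lemma 5.2.2 (PDF p. 28 L20–21)] [cite: Brink2007, Cor. 1] -/
theorem loc1_descendUnramified_of_degreeOne (hK : IsImaginaryQuadratic K) (hκ : κ.IsAnticyclotomic)
    (w : HeightOneSpectrum (𝓞 K)) (hw : ((p : ℕ) : 𝓞 K) ∉ w.asIdeal)
    (he : w.asIdeal.ramificationIdx (𝓞 ℚ) = 1) (hf : w.asIdeal.inertiaDeg (𝓞 ℚ) = 1) :
    LOC1 S (TelescopeK2RepDescent.descendUnramified S (AnticyclotomicBigGaloisRep κ ρ) hS) (Sum.inr w) := by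
  obtain ⟨σ, hσ⟩ := exists_apply_absGaloisRestrict_ne_one_of_degreeOne hK κ hκ w hw he hf
  exact loc1_descendUnramified_of_isCofree S κ ρ hS hinj hA hcof (Sum.inr w) σ hσ

include hinj hA hcof in
/-- **`corank_{𝒪⟦T⟧} H⁰(K_w, 𝐃) = 0` at a degree-one prime `w ∤ p`** (`K` imaginary quadratic, `κ` anticyclotomic), cofree `A`, any `ρ` —
the `h⁰_w` half of the row `hcot`. [cite: Greenberg2006, Prop. 4.2 (§4 A, p. 368)] [cite: Brink2007, Cor. 1] -/
theorem hasCorank_localH0_descendUnramified_zero_of_degreeOne [IsTopologicalAddGroup (BigRepModule 𝒪 p A)]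
    [ContinuousSMul (PowerSeries 𝒪) (BigRepModule 𝒪 p A)]
    (hK : IsImaginaryQuadratic K) (hκ : κ.IsAnticyclotomic)
    (w : HeightOneSpectrum (𝓞 K)) (hw : ((p : ℕ) : 𝓞 K) ∉ w.asIdeal)
    (he : w.asIdeal.ramificationIdx (𝓞 ℚ) = 1) (hf : w.asIdeal.inertiaDeg (𝓞 ℚ) = 1) :
    HasCorank (PowerSeries 𝒪)
      ((localRep S (TelescopeK2RepDescent.descendUnramified S (AnticyclotomicBigGaloisRep κ ρ) hS) (Sum.inr w)).H 0) 0 := by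
  obtain ⟨σ, hσ⟩ := exists_apply_absGaloisRestrict_ne_one_of_degreeOne hK κ hκ w hw he hf
  exact hasCorank_localH0_descendUnramified_zero_of_isCofree S κ ρ hS hinj hA hcof (Sum.inr w) σ hσ

end Anticyclotomic

end Summit.BirchSwinnertonDyer.BirchSwinnertonDyer.Theorems.TelescopeK2BigRepLOC1

end
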